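import Literature.NumberTheory.Transcendental.KZProduct
import Literature.NumberTheory.Transcendental.MZVSimplexRep
import Mathlib.Data.Finset.Sort
import HarnessLib

/-!
# Product maps of `M_{0,n}` in simplicial coordinates (Brown–Carr–Schneps product types)

Definition request `defn-GenusZeroProductType` (line `stokes-free-product-saturation` of crux
`DihedralNormalForm`, `Summits/KontsevichZagierPeriods`). Companion to `KZCalculus.lean`,
`KZProduct.lean`, `KZUnfolding.lean` and `MZVSimplexRep.lean`.

Fix a dimension `k` and the open cell `Δ_k = KZ.openOrderedSimplex k = {1 > t₀ > ⋯ > t_{k-1} > 0}`,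
read as the standard cell of the real moduli space `M_{0,k+3}(ℝ)` with marked points
`0, t_{k-1}, …, t₀, 1, ∞` in simplicial coordinates (Brown, *Ann. ENS* 42 (2009), §2.1; Brown–
Carr–Schneps, *Compositio* 146 (2010), §2, Def. 2.6). The `k + 2` FINITE marked points are
labelled by `Fin (k + 2)`: label `0` is the point `0`, label `i` (`1 ≤ i ≤ k`) is `t_{k-i}`, label
`k + 1` is the point `1` (`KZ.markedPoint`); on `Δ_k` the label order is the order on the real line.

A *product map* (Brown 2009, §2.7, eq. (2.31); BCS 2010, §2.3.2) `f = f_{T₁} × f_{T₂} : M_{0,S} →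
M_{0,T₁} × M_{0,T₂}` is given by two subsets `T₁, T₂` of the marked points with `T₁ ∪ T₂ = S`,
`|T₁ ∩ T₂| = 3`; it is a birational embedding and `f⁻¹(X_{T₁,δ₁} × X_{T₂,δ₂})` is the disjoint
union of the cells `X_γ` of `M_{0,S}(ℝ)` over the dihedral orders `γ` compatible with both factors
(Brown 2009, eq. (2.35); BCS 2010, Prop. 2.19: the *modular shuffle* `γ₁ ш γ₂`). Up to the dihedral
symmetry of the cell every product type has `∞ ∈ T₁ ∩ T₂`; we formalise exactly these, for which
both forgetful maps are AFFINE normalisations of the finite marked points: a type is a pair of sets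
of finite labels `A, B ⊆ Fin (k + 2)` with `A ∪ B = everything`, `|A ∩ B| = 2`
(`KZ.GenusZeroProductType a b`, `k = a + b`, `|A| = a + 2`, `|B| = b + 2`).

## Main definitions (all closed terms over `Fin` arithmetic)

* `KZ.markedPoint k t : Fin (k + 2) → ℝ`, `KZ.markedPoly` (the same as `ℚ`-polynomials),
  `KZ.coordLabel k i` (the label of the coordinate `tᵢ`).
* `KZ.shuffleCell k σ` (`σ : Equiv.Perm (Fin (k + 2))`, position `↦` label): the open cell
  `X_σ = {t | m_{σ 0}(t) < m_{σ 1}(t) < ⋯ < m_{σ (k+1)}(t)}`; `shuffleCell k 1 = Δ_k`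
  (`KZ.shuffleCell_one`); `ℚ`-semialgebraic and open (`KZ.isSemialgebraic_shuffleCell`,
  `KZ.isOpen_shuffleCell`). Cells other than `Δ_k` may leave `(0,1)^k`.
* `KZ.pointRatio k α β c t = (m_c − m_α)/(m_β − m_α)`: the affine normalisation `α ↦ 0`, `β ↦ 1`,
  `∞ ↦ ∞` applied to the point `c`.
* `KZ.GenusZeroProductType a b` with `minA/maxA/innerLabelA` (inner labels in DECREASING order),
  the factor maps `normA : ℝ^{a+b} → ℝ^a`, `normB`, the product map `prodMap = Fin.append normA normB`
  (BCS `f = f_{T₁} × f_{T₂}` in simplicial coordinates on source and target), its closed-form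
  Jacobian `prodMapAbsDet` (`|m_i − m_j| / (|m_{max A} − m_{min A}|^{a+1} |m_{max B} − m_{min B}|^{b+1})`,
  `{i, j} = A ∩ B`), the shuffle set `shuffles` (arrangements of the labels extending the label
  order on `A` and on `B` = BCS's `γ_A ш γ_B`, Def. 2.15) and the product domain `KZ.simplexProd`.
* `KZ.relabelTransport k σ : ℝ^k → ℝ^k`, the automorphism of `M_{0,k+3}` relabelling the marked
  points by `σ` (label permutation fixing `∞`), written in simplicial coordinates — it carries `Δ_k`
  onto `X_σ` — and its closed-form Jacobian `KZ.relabelAbsDet k σ t = |m_{σ⁻¹(k+1)} − m_{σ⁻¹ 0}|^{-(k+1)}`.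
* `KZ.genericLocus k` — points with pairwise distinct marked points (the real points of
  `M_{0,k+3}` in the chart; open, contains every cell); `denA`, `denB` — the denominators of
  `f_A`, `f_B`.
* Companion files (all PROOFS, no further named facts): `GenusZeroProductTypeMaps.lean` — `T_σ`
  carries `Δ_k` bijectively onto `X_σ` (explicit inverse `T_{σ⁻¹}`), `f` is injective on every cell
  and maps shuffle cells into `Δ_a × Δ_b`, semialgebraicity and differentiability, the relabelling
  move `[Δ_k, (G ∘ T_σ)·|det DT_σ|] − [X_σ, G] ∈ KZ.changeOfVariablesRel`;
  `GenusZeroProductTypeJacobian.lean` — `|det DT_σ| = relabelAbsDet` in general (action of the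
  symmetric group, swap induction); `GenusZeroProductTypeProdJacobian.lean` —
  `|det Df| = prodMapAbsDet` in general (factorisation `f = (T_{κ_A} × T_{κ_B}) ∘ T_Π`), the rational
  inverse of `f`, and the calibration below; `GenusZeroProductTypeCover.lean` —
  `f⁻¹(Δ_a × Δ_b) ∩ generic = ⊔_{σ ∈ shuffles} X_σ` and the images cover `Δ_a × Δ_b` up to a null
  set; `GenusZeroProductTypeDissection.lean` — BCS Prop. 2.19 inside the KZ calculus
  (`KZ.ProductCellDissection`: `[Δ_a × Δ_b, g] − Σ_{σ ∈ shuffles} [X_σ, (g ∘ f)·|det Df|]` lies in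
  the subgroup generated by domain additivity and changes of variables), PROVED
  (`KZ.ProductCellDissection_holds`), with its form transported to the standard cell.

## Calibration (`k = 2`; see `GenusZeroProductTypeProdJacobian.lean`)

* `splitType`: `A = {0, t₁, 1}`, `B = {t₁, t₀, 1}` — one shuffle cell, `f(t) = (t₁, (t₀−t₁)/(1−t₁))`,
  Jacobian `1/(1 − t₁)`.
* `concatType`: `A = {0, t₀, 1}`, `B = {0, t₁, 1}` — `f = id`, two shuffle cells (`Δ₂` and its
  image under the coordinate swap), Jacobian `1`.
* Counts (by enumeration outside Lean): `k = 2` has `12` types with `18` shuffle cells in all;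
  `k = 3` has `60` types with `120` shuffle cells (`18` single-cell types).

## References

* F. Brown, S. Carr, L. Schneps, *The algebra of cell-zeta values*, Compositio Math. 146 (2010)
  731–771 [BrownCarrSchneps2010]: Def. 2.2, Def. 2.6 (standard cell = simplex), Def. 2.15
  (shuffles w.r.t. three points), Prop. 2.19 (modular shuffle relation / product map), Def. 2.22.
* F. Brown, *Multiple zeta values and periods of moduli spaces `M̄_{0,n}`*, Ann. Sci. ÉNS 42 (2009)
  371–489 [BrownENS2009]: §2.1 (simplicial coordinates), §2.3 (forgetful maps), §2.7 (product maps,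
  eqs. (2.31)–(2.35)).
* M. Kontsevich, D. Zagier, *Periods* (2001), §1.2, rules (1)–(2) [KontsevichZagier2001].

## Design notes

* Types are indexed by the two factor dimensions `a b` (so `k = a + b` definitionally and
  `prodMap : ℝ^{a+b} → ℝ^{a+b}` has the shape required by `KZ.changeOfVariablesRel` and by
  `KZ.IntegralRep.prod : IntegralRep a → IntegralRep b → IntegralRep (a + b)`), not by `k` with a
  side condition `(|A| − 2) + (|B| − 2) = k`, which would force casts along `Fin` equalities.
  BCS/Brown assume `|Tᵢ| ≥ 4`, i.e. `0 < a`, `0 < b`; the degenerate types `a = 0` or `b = 0` are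
  harmless (the product map is then a relabelling of the identity) and are not excluded.
* `A ∪ B = univ` and the two cardinalities force `|A ∩ B| = 2` (`card_inter`); the common triple of
  BCS is `E = (A ∩ B) ∪ {∞}`.
* An arrangement `σ : Equiv.Perm (Fin (k+2))` is read "position `↦` label"; `X_σ` is empty unless
  label `0` precedes label `k + 1` (`m_0 = 0 < 1 = m_{k+1}`), which every shuffle satisfies.
* Jacobians are provided in CLOSED FORM (`prodMapAbsDet`, `relabelAbsDet`); their identification
  with `|(fderiv ℝ _ t).det|` is proved in the companion files (`abs_det_fderiv_relabelTransport`,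
  `abs_det_fderiv_prodMap`), not here.
-/

noncomputable section

open MeasureTheory MvPolynomial Set Finset

namespace Literature.NumberTheory.Transcendental

namespace KZ

variable {k : ℕ}

/-! ### Finite marked points of the cell of `M_{0,k+3}(ℝ)` -/

/-- The values of the `k + 2` finite marked points `0, t_{k-1}, …, t₀, 1` of a point
`t ∈ ℝ^k` (simplicial coordinates on `M_{0,k+3}`, the point `∞` being dropped): label `0 ↦ 0`,
label `i ↦ t_{k-i}` for `1 ≤ i ≤ k`, label `k + 1 ↦ 1`. On the cell `1 > t₀ > ⋯ > t_{k-1} > 0` the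
labels are in increasing order along the real line.
[Brown 2009, §2.1; Brown–Carr–Schneps 2010, §2 and Def. 2.6] [cite: BrownCarrSchneps2010, Def. 2.6] -/
def markedPoint (k : ℕ) (t : Fin k → ℝ) : Fin (k + 2) → ℝ :=
  Fin.cons 0 (Fin.snoc (fun i => t (Fin.rev i)) 1)

/-- The marked points as polynomials over `ℚ` in the coordinates: `0`, `X_{k-i}`, `1`.
[Brown 2009, §2.1] [folklore] -/
def markedPoly (k : ℕ) : Fin (k + 2) → MvPolynomial (Fin k) ℚ :=
  Fin.cons 0 (Fin.snoc (fun i => X (Fin.rev i)) 1)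

/-- The label in `Fin (k + 2)` of the coordinate `tᵢ`, namely `k - i`. [Brown 2009, §2.1] [folklore] -/
def coordLabel (k : ℕ) (i : Fin k) : Fin (k + 2) := (Fin.rev i).castSucc.succ

/-- Label `0` is the point `0`. [Brown 2009, §2.1] [folklore] -/
@[simp] theorem markedPoint_zero (t : Fin k → ℝ) : markedPoint k t 0 = 0 := by
  simp [markedPoint]

/-- Label `k + 1` is the point `1`. [Brown 2009, §2.1] [folklore] -/
@[simp] theorem markedPoint_last (t : Fin k → ℝ) : markedPoint k t (Fin.last (k + 1)) = 1 := by
  rw [markedPoint, ← Fin.succ_last, Fin.cons_succ, Fin.snoc_last]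

/-- The marked point with label `j + 1` (`j < k`) is `t_{k-1-j}`. [Brown 2009, §2.1] [folklore] -/
@[simp] theorem markedPoint_succ_castSucc (t : Fin k → ℝ) (j : Fin k) :
    markedPoint k t j.castSucc.succ = t j.rev := by
  rw [markedPoint, Fin.cons_succ, Fin.snoc_castSucc]

/-- The marked point labelled `coordLabel k i` is the coordinate `tᵢ`. [Brown 2009, §2.1] [folklore] -/
@[simp] theorem markedPoint_coordLabel (t : Fin k → ℝ) (i : Fin k) :
    markedPoint k t (coordLabel k i) = t i := by
  rw [coordLabel, markedPoint_succ_castSucc, Fin.rev_rev]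

/-- The label of the coordinate `t_{k-1-j}` is `j + 1`. [folklore] -/
@[simp] theorem coordLabel_rev (j : Fin k) : coordLabel k j.rev = j.castSucc.succ := by
  rw [coordLabel, Fin.rev_rev]

/-- `coordLabel` is injective. [folklore] -/
theorem coordLabel_injective (k : ℕ) : Function.Injective (coordLabel k) := by
  intro i j h
  simpa [coordLabel, Fin.castSucc_inj, Fin.succ_inj] using h

/-- The label of a coordinate is neither `0` nor `k + 1`. [folklore] -/
theorem coordLabel_ne_zero (i : Fin k) : coordLabel k i ≠ 0 := Fin.succ_ne_zero _

/-- The label of a coordinate is neither `0` nor `k + 1`. [folklore] -/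
theorem coordLabel_ne_last (i : Fin k) : coordLabel k i ≠ Fin.last (k + 1) := by
  rw [coordLabel, ← Fin.succ_last, Ne, Fin.succ_inj]
  exact (Fin.castSucc_lt_last _).ne

/-- Every label is `0`, `k + 1` or the label of a coordinate. [folklore] -/
theorem eq_zero_or_eq_last_or_exists_eq_coordLabel (s : Fin (k + 2)) :
    s = 0 ∨ s = Fin.last (k + 1) ∨ ∃ i, s = coordLabel k i := by
  induction s using Fin.cases with
  | zero => exact Or.inl rfl
  | succ j =>
    induction j using Fin.lastCases with
    | last => exact Or.inr (Or.inl (Fin.succ_last _).symm)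
    | cast i => exact Or.inr (Or.inr ⟨i.rev, (coordLabel_rev i).symm⟩)

/-- The marked points are the values of the polynomials `markedPoly`. [Brown 2009, §2.1] [folklore] -/
@[simp] theorem aeval_markedPoly (t : Fin k → ℝ) (s : Fin (k + 2)) :
    aeval t (markedPoly k s) = markedPoint k t s := by
  induction s using Fin.cases with
  | zero => simp [markedPoly, markedPoint]
  | succ j =>
    induction j using Fin.lastCases with
    | last => simp [markedPoly, markedPoint]
    | cast i => simp [markedPoly, markedPoint]

/-- Each marked point depends continuously (indeed affinely) on `t`. [folklore] -/
theorem continuous_markedPoint (s : Fin (k + 2)) : Continuous fun t : Fin k → ℝ => markedPoint k t s := by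
  rcases eq_zero_or_eq_last_or_exists_eq_coordLabel s with rfl | rfl | ⟨i, rfl⟩
  · simp only [markedPoint_zero]; exact continuous_const
  · simp only [markedPoint_last]; exact continuous_const
  · simp only [markedPoint_coordLabel]; exact continuous_apply i

/-- A point of `ℝ^k` is recovered from its marked points. [folklore] -/
theorem eq_of_markedPoint_eq {t t' : Fin k → ℝ} (h : markedPoint k t = markedPoint k t') : t = t' := by
  ext i
  rw [← markedPoint_coordLabel t i, ← markedPoint_coordLabel t' i, h]

/-! ### Cells of `M_{0,k+3}(ℝ)` in simplicial coordinates -/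

/-- The open cell `X_σ ⊆ ℝ^k` of the arrangement `σ` (position `↦` label): the set of `t` whose
finite marked points appear on the real line in the order `σ 0, σ 1, …, σ (k+1)` (followed by
`∞`); these are the connected components `X_{S,γ}` of `M_{0,k+3}(ℝ)` (one per dihedral structure
`γ`) that are visible in the simplicial chart, `X_1` being the standard cell. For a product type
the cells indexed by its shuffles are the *shuffle cells* of BCS Prop. 2.19.
[Brown 2009, §2.7, eq. (2.35); Brown–Carr–Schneps 2010, §2.1 (cells `X_{S,η}`), Prop. 2.19] [cite: BrownCarrSchneps2010, Prop. 2.19] -/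
def shuffleCell (k : ℕ) (σ : Equiv.Perm (Fin (k + 2))) : Set (Fin k → ℝ) :=
  {t | StrictMono (markedPoint k t ∘ σ)}

/-- Membership in a cell, unfolded. [folklore] -/
theorem mem_shuffleCell_iff {σ : Equiv.Perm (Fin (k + 2))} {t : Fin k → ℝ} :
    t ∈ shuffleCell k σ ↔ StrictMono (markedPoint k t ∘ σ) := Iff.rfl

/-- Membership in a cell through successive marked points. [folklore] -/
theorem mem_shuffleCell_iff_forall {σ : Equiv.Perm (Fin (k + 2))} {t : Fin k → ℝ} :
    t ∈ shuffleCell k σ ↔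
      ∀ p : Fin (k + 1), markedPoint k t (σ p.castSucc) < markedPoint k t (σ p.succ) := by
  rw [mem_shuffleCell_iff, Fin.strictMono_iff_lt_succ]
  rfl

/-- In the cell `X_σ`, the marked point `x` lies to the left of `y` iff `x` comes before `y` in the
arrangement `σ`. [folklore] -/
theorem markedPoint_lt_markedPoint_iff {σ : Equiv.Perm (Fin (k + 2))} {t : Fin k → ℝ}
    (ht : t ∈ shuffleCell k σ) {x y : Fin (k + 2)} :
    markedPoint k t x < markedPoint k t y ↔ σ.symm x < σ.symm y := by
  have hx : markedPoint k t x = (markedPoint k t ∘ σ) (σ.symm x) := by simp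
  have hy : markedPoint k t y = (markedPoint k t ∘ σ) (σ.symm y) := by simp
  rw [hx, hy, ht.lt_iff_lt]

/-- In a cell the marked points are pairwise distinct. [folklore] -/
theorem injective_markedPoint_of_mem_shuffleCell {σ : Equiv.Perm (Fin (k + 2))} {t : Fin k → ℝ}
    (ht : t ∈ shuffleCell k σ) : Function.Injective (markedPoint k t) := by
  have : markedPoint k t = (markedPoint k t ∘ σ) ∘ σ.symm := by ext x; simp
  rw [this]
  exact ht.injective.comp σ.symm.injective

/-- **The standard cell is the open ordered simplex**: `X_1 = {1 > t₀ > ⋯ > t_{k-1} > 0} = Δ_k`.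
[Brown–Carr–Schneps 2010, Def. 2.6; Brown 2009, §2.7] [cite: BrownCarrSchneps2010, Def. 2.6] -/
theorem shuffleCell_one (k : ℕ) : shuffleCell k 1 = openOrderedSimplex k := by
  ext t
  simp only [mem_shuffleCell_iff, Equiv.Perm.coe_one, Function.comp_id, openOrderedSimplex,
    mem_setOf_eq]
  constructor
  · intro h
    refine ⟨fun i => ?_, fun i => ?_, fun i j hij => ?_⟩
    · have h0 : (0 : Fin (k + 2)) < coordLabel k i := Fin.succ_pos _
      simpa using h h0
    · have := h (show coordLabel k i < Fin.last (k + 1) from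
        lt_of_le_of_ne (Fin.le_last _) (coordLabel_ne_last i))
      simpa using this
    · have hlt : coordLabel k j < coordLabel k i := by
        simp only [coordLabel, Fin.succ_lt_succ_iff, Fin.castSucc_lt_castSucc_iff]
        exact Fin.rev_lt_rev.mpr hij
      simpa using h hlt
  · rintro ⟨h0, h1, hanti⟩ x y hxy
    rcases eq_zero_or_eq_last_or_exists_eq_coordLabel y with rfl | rfl | ⟨j, rfl⟩
    · exact absurd hxy (Fin.not_lt_zero x)
    · rcases eq_zero_or_eq_last_or_exists_eq_coordLabel x with rfl | rfl | ⟨i, rfl⟩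
      · simp
      · exact absurd hxy (lt_irrefl _)
      · simpa using h1 i
    · rcases eq_zero_or_eq_last_or_exists_eq_coordLabel x with rfl | rfl | ⟨i, rfl⟩
      · simpa using h0 j
      · exact absurd hxy (not_lt.mpr (Fin.le_last _))
      · have hji : j < i := by
          simp only [coordLabel, Fin.succ_lt_succ_iff, Fin.castSucc_lt_castSucc_iff,
            Fin.rev_lt_rev] at hxy
          exact hxy
        simpa using hanti hji

/-- **Cells are `ℚ`-semialgebraic**: `X_σ` is the finite intersection of the strict polynomial
inequalities `m_{σ p} < m_{σ (p+1)}`. [Kontsevich–Zagier 2001, §1.1; Brown 2009, §2.7] [folklore] -/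
theorem isSemialgebraic_shuffleCell (k : ℕ) (σ : Equiv.Perm (Fin (k + 2))) :
    Literature.ModelTheory.ExponentialFields.IsSemialgebraic ℚ (shuffleCell k σ) := by
  have : shuffleCell k σ = ⋂ p ∈ (Finset.univ : Finset (Fin (k + 1))),
      {t : Fin k → ℝ | aeval t (markedPoly k (σ p.castSucc)) < aeval t (markedPoly k (σ p.succ))} := by
    ext t
    simp [mem_shuffleCell_iff_forall]
  rw [this]
  exact Literature.ModelTheory.ExponentialFields.IsSemialgebraic.biInter _ _ fun p _ =>
    Literature.ModelTheory.ExponentialFields.isSemialgebraic_setOf_eval_lt _ _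

/-- Cells are open subsets of `ℝ^k`. [folklore] -/
theorem isOpen_shuffleCell (k : ℕ) (σ : Equiv.Perm (Fin (k + 2))) : IsOpen (shuffleCell k σ) := by
  have : shuffleCell k σ = ⋂ p : Fin (k + 1),
      {t : Fin k → ℝ | markedPoint k t (σ p.castSucc) < markedPoint k t (σ p.succ)} := by
    ext t
    simp [mem_shuffleCell_iff_forall]
  rw [this]
  exact isOpen_iInter_of_finite fun p =>
    isOpen_lt (continuous_markedPoint _) (continuous_markedPoint _)

/-- Cells are Lebesgue measurable. [folklore] -/
theorem measurableSet_shuffleCell (k : ℕ) (σ : Equiv.Perm (Fin (k + 2))) :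
    MeasurableSet (shuffleCell k σ) :=
  (isOpen_shuffleCell k σ).measurableSet

/-- The cell `X_σ` is empty unless label `0` (the point `0`) precedes label `k + 1` (the point `1`)
in the arrangement. [folklore] -/
theorem symm_zero_lt_symm_last_of_mem_shuffleCell {σ : Equiv.Perm (Fin (k + 2))} {t : Fin k → ℝ}
    (ht : t ∈ shuffleCell k σ) : σ.symm 0 < σ.symm (Fin.last (k + 1)) := by
  rw [← markedPoint_lt_markedPoint_iff ht, markedPoint_zero, markedPoint_last]
  exact zero_lt_one

/-! ### The generic locus -/

/-- The *generic locus* of `ℝ^k`: points whose `k + 2` finite marked points are pairwise distinct,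
i.e. the complement of the hyperplane arrangement `{tᵢ = tⱼ} ∪ {tᵢ = 0} ∪ {tᵢ = 1}` — the real
points of `M_{0,k+3}` in the simplicial chart; it is the disjoint union of the open cells `X_σ`.
[Brown 2009, §2.1, eq. (2.3); Brown–Carr–Schneps 2010, eq. (2.2)] [cite: BrownENS2009, §2.1] -/
def genericLocus (k : ℕ) : Set (Fin k → ℝ) := {t | Function.Injective (markedPoint k t)}

/-- Membership in the generic locus, unfolded. [folklore] -/
theorem mem_genericLocus_iff {t : Fin k → ℝ} :
    t ∈ genericLocus k ↔ Function.Injective (markedPoint k t) := Iff.rfl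

/-- The generic locus is open. [folklore] -/
theorem isOpen_genericLocus (k : ℕ) : IsOpen (genericLocus k) := by
  have : genericLocus k = ⋂ x : Fin (k + 2), ⋂ y : Fin (k + 2),
      {t : Fin k → ℝ | x ≠ y → markedPoint k t x ≠ markedPoint k t y} := by
    ext t
    simp only [mem_genericLocus_iff, Function.Injective, mem_iInter, mem_setOf_eq]
    exact ⟨fun h x y hxy hm => hxy (h hm), fun h x y hm => by_contra fun hxy => h x y hxy hm⟩
  rw [this]
  refine isOpen_iInter_of_finite fun x => isOpen_iInter_of_finite fun y => ?_
  by_cases hxy : x = y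
  · have : {t : Fin k → ℝ | x ≠ y → markedPoint k t x ≠ markedPoint k t y} = univ :=
      eq_univ_of_forall fun t h => absurd hxy h
    rw [this]; exact isOpen_univ
  · have : {t : Fin k → ℝ | x ≠ y → markedPoint k t x ≠ markedPoint k t y} =
        {t | markedPoint k t x ≠ markedPoint k t y} := by
      ext t; simp [hxy]
    rw [this]
    exact isOpen_ne_fun (continuous_markedPoint x) (continuous_markedPoint y)

/-- Every cell lies in the generic locus. [folklore] -/
theorem shuffleCell_subset_genericLocus (σ : Equiv.Perm (Fin (k + 2))) :
    shuffleCell k σ ⊆ genericLocus k := fun _ ht => injective_markedPoint_of_mem_shuffleCell ht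

/-- The standard cell lies in the generic locus. [folklore] -/
theorem openOrderedSimplex_subset_genericLocus (k : ℕ) : openOrderedSimplex k ⊆ genericLocus k := by
  rw [← shuffleCell_one]; exact shuffleCell_subset_genericLocus 1

/-! ### Affine normalisations -/

/-- The affine normalisation of the marked point `c` with respect to `(α, β)`:
`(m_c − m_α)/(m_β − m_α)`, i.e. the image of `c` under the real Möbius (here affine) map sending
`α ↦ 0`, `β ↦ 1`, `∞ ↦ ∞` — the simplicial coordinate of `c` on `M_{0,T}` for any set of marked
points `T ∋ α, β, c, ∞` (the forgetful map `f_T` in coordinates).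
[Brown 2009, §2.3 and §2.7; Brown–Carr–Schneps 2010, §2.3.2] [cite: BrownENS2009, §2.7] -/
def pointRatio (k : ℕ) (α β c : Fin (k + 2)) (t : Fin k → ℝ) : ℝ :=
  (markedPoint k t c - markedPoint k t α) / (markedPoint k t β - markedPoint k t α)

/-- Unfolding `pointRatio`. [folklore] -/
theorem pointRatio_def (α β c : Fin (k + 2)) (t : Fin k → ℝ) :
    pointRatio k α β c t =
      (markedPoint k t c - markedPoint k t α) / (markedPoint k t β - markedPoint k t α) := rfl

/-- The normalisation sends `α` to `0`. [folklore] -/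
@[simp] theorem pointRatio_left (α β : Fin (k + 2)) (t : Fin k → ℝ) : pointRatio k α β α t = 0 := by
  simp [pointRatio]

/-- The normalisation sends `β` to `1` (when `m_β ≠ m_α`). [folklore] -/
theorem pointRatio_right {α β : Fin (k + 2)} {t : Fin k → ℝ}
    (h : markedPoint k t β - markedPoint k t α ≠ 0) : pointRatio k α β β t = 1 := by
  simp [pointRatio, div_self h]

/-- Normalising with respect to the points `0` and `1` themselves changes nothing. [folklore] -/
@[simp] theorem pointRatio_zero_last (c : Fin (k + 2)) (t : Fin k → ℝ) :
    pointRatio k 0 (Fin.last (k + 1)) c t = markedPoint k t c := by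
  simp [pointRatio]

/-- `pointRatio` is a quotient of polynomials over `ℚ`. [folklore] -/
theorem pointRatio_eq_aeval_div_aeval (α β c : Fin (k + 2)) (t : Fin k → ℝ) :
    pointRatio k α β c t =
      aeval t (markedPoly k c - markedPoly k α) / aeval t (markedPoly k β - markedPoly k α) := by
  simp [pointRatio]

/-- **Affine ratios compose**: normalising first with respect to `(α, β)` and then with respect
to (the images of) `(γ, δ)` is normalising with respect to `(γ, δ)` — the cocycle property of the
forgetful maps / Möbius invariance of ratios of differences. [Brown 2009, §2.3] [folklore] -/
theorem pointRatio_pointRatio {α β γ δ c : Fin (k + 2)} {t : Fin k → ℝ}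
    (h : markedPoint k t β - markedPoint k t α ≠ 0) :
    (pointRatio k α β c t - pointRatio k α β γ t) / (pointRatio k α β δ t - pointRatio k α β γ t) =
      pointRatio k γ δ c t := by
  simp only [pointRatio]
  rw [div_sub_div_same, div_sub_div_same, div_div_div_cancel_right₀ h]
  congr 1 <;> ring

/-! ### Product types -/

/-- **A genus-zero (BCS) product type** of factor dimensions `a`, `b` on the cell of
`M_{0,a+b+3}`: two sets `A`, `B` of finite labels with `|A| = a + 2`, `|B| = b + 2` and
`A ∪ B = ` all `a + b + 2` finite labels — hence `|A ∩ B| = 2` (`card_inter`). With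
`T₁ = A ∪ {∞}`, `T₂ = B ∪ {∞}` these are exactly Brown's data `T₁ ∪ T₂ = S`, `|T₁ ∩ T₂| = 3` of
a product map `f_{T₁} × f_{T₂} : M_{0,S} → M_{0,T₁} × M_{0,T₂}` (`dim = a + b = dim + dim`) having
`∞` among the three common points; every product type is of this form up to a dihedral symmetry
of the cell. BCS/Brown assume `|Tᵢ| ≥ 4`, i.e. `0 < a`, `0 < b`; the degenerate types are not
excluded here. [Brown 2009, §2.7, eq. (2.31); Brown–Carr–Schneps 2010, §2.3.1 eq. (2.13), Prop. 2.19]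
[cite: BrownCarrSchneps2010, Prop. 2.19] -/
@[ext] structure GenusZeroProductType (a b : ℕ) where
  /-- The finite marked points of the first factor (`T₁ = A ∪ {∞}`). -/
  A : Finset (Fin (a + b + 2))
  /-- The finite marked points of the second factor (`T₂ = B ∪ {∞}`). -/
  B : Finset (Fin (a + b + 2))
  /-- The first factor `M_{0,T₁}` has dimension `|A| + 1 - 3 = a`. -/
  card_A : A.card = a + 2
  /-- The second factor `M_{0,T₂}` has dimension `|B| + 1 - 3 = b`. -/
  card_B : B.card = b + 2
  /-- Every marked point is remembered by one of the factors (`S = T₁ ∪ T₂`). -/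
  union : A ∪ B = Finset.univ

namespace GenusZeroProductType

variable {a b : ℕ} (T : GenusZeroProductType a b)

/-- `|A ∩ B| = 2`: together with `∞` the two factors have exactly three marked points in common
(`|T₁ ∩ T₂| = 3`). [Brown 2009, §2.7, eq. (2.31)] [cite: BrownENS2009, §2.7] -/
theorem card_inter : (T.A ∩ T.B).card = 2 := by
  have h := Finset.card_union_add_card_inter T.A T.B
  rw [T.union, T.card_A, T.card_B, Finset.card_univ, Fintype.card_fin] at h
  omega

/-- `A` is non-empty. [folklore] -/
theorem nonempty_A : T.A.Nonempty := by rw [← Finset.card_pos, T.card_A]; omega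
/-- `B` is non-empty. [folklore] -/
theorem nonempty_B : T.B.Nonempty := by rw [← Finset.card_pos, T.card_B]; omega
/-- `A ∩ B` is non-empty. [folklore] -/
theorem nonempty_inter : (T.A ∩ T.B).Nonempty := by rw [← Finset.card_pos, T.card_inter]; omega

/-- Every label lies in `A` or in `B`. [folklore] -/
theorem mem_A_or_mem_B (x : Fin (a + b + 2)) : x ∈ T.A ∨ x ∈ T.B := by
  have h := Finset.mem_univ x
  rw [← T.union, Finset.mem_union] at h
  exact h

/-- The smallest label of `A` (normalised to `0` by `f_A`). [Brown–Carr–Schneps 2010, §2.3.2] [folklore] -/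
def minA : Fin (a + b + 2) := T.A.min' T.nonempty_A
/-- The largest label of `A` (normalised to `1` by `f_A`). [Brown–Carr–Schneps 2010, §2.3.2] [folklore] -/
def maxA : Fin (a + b + 2) := T.A.max' T.nonempty_A
/-- The smallest label of `B` (normalised to `0` by `f_B`). [Brown–Carr–Schneps 2010, §2.3.2] [folklore] -/
def minB : Fin (a + b + 2) := T.B.min' T.nonempty_B
/-- The largest label of `B` (normalised to `1` by `f_B`). [Brown–Carr–Schneps 2010, §2.3.2] [folklore] -/
def maxB : Fin (a + b + 2) := T.B.max' T.nonempty_B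
/-- The smaller of the two common labels `A ∩ B`. [Brown 2009, §2.7] [folklore] -/
def lo : Fin (a + b + 2) := (T.A ∩ T.B).min' T.nonempty_inter
/-- The larger of the two common labels `A ∩ B`. [Brown 2009, §2.7] [folklore] -/
def hi : Fin (a + b + 2) := (T.A ∩ T.B).max' T.nonempty_inter

/-- `min A ∈ A`. [folklore] -/
theorem minA_mem : T.minA ∈ T.A := Finset.min'_mem _ _
/-- `max A ∈ A`. [folklore] -/
theorem maxA_mem : T.maxA ∈ T.A := Finset.max'_mem _ _
/-- `min B ∈ B`. [folklore] -/
theorem minB_mem : T.minB ∈ T.B := Finset.min'_mem _ _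
/-- `max B ∈ B`. [folklore] -/
theorem maxB_mem : T.maxB ∈ T.B := Finset.max'_mem _ _
/-- `lo ∈ A ∩ B`. [folklore] -/
theorem lo_mem : T.lo ∈ T.A ∩ T.B := Finset.min'_mem _ _
/-- `hi ∈ A ∩ B`. [folklore] -/
theorem hi_mem : T.hi ∈ T.A ∩ T.B := Finset.max'_mem _ _
/-- `min A` is the least label of `A`. [folklore] -/
theorem minA_le {x} (hx : x ∈ T.A) : T.minA ≤ x := Finset.min'_le _ _ hx
/-- `max A` is the largest label of `A`. [folklore] -/
theorem le_maxA {x} (hx : x ∈ T.A) : x ≤ T.maxA := Finset.le_max' _ _ hx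
/-- `min B` is the least label of `B`. [folklore] -/
theorem minB_le {x} (hx : x ∈ T.B) : T.minB ≤ x := Finset.min'_le _ _ hx
/-- `max B` is the largest label of `B`. [folklore] -/
theorem le_maxB {x} (hx : x ∈ T.B) : x ≤ T.maxB := Finset.le_max' _ _ hx

/-- `min A < max A` (`|A| ≥ 2`). [folklore] -/
theorem minA_lt_maxA : T.minA < T.maxA :=
  Finset.min'_lt_max'_of_card _ (by rw [T.card_A]; omega)
/-- `min B < max B` (`|B| ≥ 2`). [folklore] -/
theorem minB_lt_maxB : T.minB < T.maxB :=
  Finset.min'_lt_max'_of_card _ (by rw [T.card_B]; omega)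
/-- `lo < hi` (`|A ∩ B| = 2`). [folklore] -/
theorem lo_lt_hi : T.lo < T.hi :=
  Finset.min'_lt_max'_of_card _ (by rw [T.card_inter]; omega)

/-- The common labels are exactly `lo` and `hi`. [folklore] -/
theorem inter_eq : T.A ∩ T.B = {T.lo, T.hi} := by
  symm
  apply Finset.eq_of_subset_of_card_le
  · intro x hx
    simp only [Finset.mem_insert, Finset.mem_singleton] at hx
    rcases hx with rfl | rfl
    exacts [T.lo_mem, T.hi_mem]
  · rw [T.card_inter, Finset.card_pair T.lo_lt_hi.ne]

/-- The inner labels of `A` (all but the smallest and the largest). [Brown–Carr–Schneps 2010, §2.3.2] [folklore] -/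
def innerA : Finset (Fin (a + b + 2)) := (T.A.erase T.minA).erase T.maxA
/-- The inner labels of `B` (all but the smallest and the largest). [Brown–Carr–Schneps 2010, §2.3.2] [folklore] -/
def innerB : Finset (Fin (a + b + 2)) := (T.B.erase T.minB).erase T.maxB

/-- `A` has `a` inner labels. [folklore] -/
theorem card_innerA : T.innerA.card = a := by
  have h1 : T.maxA ∈ T.A.erase T.minA := Finset.mem_erase.mpr ⟨T.minA_lt_maxA.ne', T.maxA_mem⟩
  rw [innerA, Finset.card_erase_of_mem h1, Finset.card_erase_of_mem T.minA_mem, T.card_A]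
  rfl

/-- `B` has `b` inner labels. [folklore] -/
theorem card_innerB : T.innerB.card = b := by
  have h1 : T.maxB ∈ T.B.erase T.minB := Finset.mem_erase.mpr ⟨T.minB_lt_maxB.ne', T.maxB_mem⟩
  rw [innerB, Finset.card_erase_of_mem h1, Finset.card_erase_of_mem T.minB_mem, T.card_B]
  rfl

/-- A label is inner in `A` iff it lies strictly between `min A` and `max A`. [folklore] -/
theorem mem_innerA_iff {x} : x ∈ T.innerA ↔ x ∈ T.A ∧ T.minA < x ∧ x < T.maxA := by
  simp only [innerA, Finset.mem_erase]
  constructor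
  · rintro ⟨h1, h2, h3⟩
    exact ⟨h3, lt_of_le_of_ne (T.minA_le h3) (Ne.symm h2), lt_of_le_of_ne (T.le_maxA h3) h1⟩
  · rintro ⟨h1, h2, h3⟩
    exact ⟨h3.ne, h2.ne', h1⟩

/-- A label is inner in `B` iff it lies strictly between `min B` and `max B`. [folklore] -/
theorem mem_innerB_iff {x} : x ∈ T.innerB ↔ x ∈ T.B ∧ T.minB < x ∧ x < T.maxB := by
  simp only [innerB, Finset.mem_erase]
  constructor
  · rintro ⟨h1, h2, h3⟩
    exact ⟨h3, lt_of_le_of_ne (T.minB_le h3) (Ne.symm h2), lt_of_le_of_ne (T.le_maxB h3) h1⟩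
  · rintro ⟨h1, h2, h3⟩
    exact ⟨h3.ne, h2.ne', h1⟩

/-- The inner labels of `A` in DECREASING order (so that `f_A` lands in the decreasing simplex
`Δ_a` on the standard cell). [Brown–Carr–Schneps 2010, Def. 2.6] [folklore] -/
def innerLabelA (i : Fin a) : Fin (a + b + 2) := T.innerA.orderEmbOfFin T.card_innerA (Fin.rev i)
/-- The inner labels of `B` in DECREASING order. [Brown–Carr–Schneps 2010, Def. 2.6] [folklore] -/
def innerLabelB (j : Fin b) : Fin (a + b + 2) := T.innerB.orderEmbOfFin T.card_innerB (Fin.rev j)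

/-- `innerLabelA i` is an inner label of `A`. [folklore] -/
theorem innerLabelA_mem_innerA (i : Fin a) : T.innerLabelA i ∈ T.innerA :=
  Finset.orderEmbOfFin_mem _ _ _
/-- `innerLabelB j` is an inner label of `B`. [folklore] -/
theorem innerLabelB_mem_innerB (j : Fin b) : T.innerLabelB j ∈ T.innerB :=
  Finset.orderEmbOfFin_mem _ _ _
/-- `innerLabelA i ∈ A`. [folklore] -/
theorem innerLabelA_mem (i : Fin a) : T.innerLabelA i ∈ T.A :=
  (T.mem_innerA_iff.mp (T.innerLabelA_mem_innerA i)).1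
/-- `innerLabelB j ∈ B`. [folklore] -/
theorem innerLabelB_mem (j : Fin b) : T.innerLabelB j ∈ T.B :=
  (T.mem_innerB_iff.mp (T.innerLabelB_mem_innerB j)).1
/-- `min A < innerLabelA i`. [folklore] -/
theorem minA_lt_innerLabelA (i : Fin a) : T.minA < T.innerLabelA i :=
  (T.mem_innerA_iff.mp (T.innerLabelA_mem_innerA i)).2.1
/-- `innerLabelA i < max A`. [folklore] -/
theorem innerLabelA_lt_maxA (i : Fin a) : T.innerLabelA i < T.maxA :=
  (T.mem_innerA_iff.mp (T.innerLabelA_mem_innerA i)).2.2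
/-- `min B < innerLabelB j`. [folklore] -/
theorem minB_lt_innerLabelB (j : Fin b) : T.minB < T.innerLabelB j :=
  (T.mem_innerB_iff.mp (T.innerLabelB_mem_innerB j)).2.1
/-- `innerLabelB j < max B`. [folklore] -/
theorem innerLabelB_lt_maxB (j : Fin b) : T.innerLabelB j < T.maxB :=
  (T.mem_innerB_iff.mp (T.innerLabelB_mem_innerB j)).2.2

/-- The inner labels of `A` are listed in decreasing order. [folklore] -/
theorem strictAnti_innerLabelA : StrictAnti T.innerLabelA := fun _ _ h =>
  (T.innerA.orderEmbOfFin T.card_innerA).strictMono (Fin.rev_lt_rev.mpr h)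
/-- The inner labels of `B` are listed in decreasing order. [folklore] -/
theorem strictAnti_innerLabelB : StrictAnti T.innerLabelB := fun _ _ h =>
  (T.innerB.orderEmbOfFin T.card_innerB).strictMono (Fin.rev_lt_rev.mpr h)

/-- Every inner label of `A` is some `innerLabelA i`. [folklore] -/
theorem exists_eq_innerLabelA {x} (hx : x ∈ T.innerA) : ∃ i, x = T.innerLabelA i := by
  have : x ∈ Set.range (T.innerA.orderEmbOfFin T.card_innerA) := by
    rw [Finset.range_orderEmbOfFin]; exact hx
  obtain ⟨i, hi⟩ := this
  exact ⟨i.rev, by rw [innerLabelA, Fin.rev_rev, hi]⟩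

/-- Every inner label of `B` is some `innerLabelB j`. [folklore] -/
theorem exists_eq_innerLabelB {x} (hx : x ∈ T.innerB) : ∃ j, x = T.innerLabelB j := by
  have : x ∈ Set.range (T.innerB.orderEmbOfFin T.card_innerB) := by
    rw [Finset.range_orderEmbOfFin]; exact hx
  obtain ⟨j, hj⟩ := this
  exact ⟨j.rev, by rw [innerLabelB, Fin.rev_rev, hj]⟩

/-! #### The factor maps and the product map -/

/-- **The first forgetful map `f_A : ℝ^{a+b} → ℝ^a` in simplicial coordinates**: the affine
normalisation `min A ↦ 0`, `max A ↦ 1`, `∞ ↦ ∞` applied to the inner points of `A`, listed in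
decreasing order of their labels. [Brown 2009, §2.7; Brown–Carr–Schneps 2010, §2.3.2, Prop. 2.19]
[cite: BrownCarrSchneps2010, Prop. 2.19] -/
def normA (t : Fin (a + b) → ℝ) : Fin a → ℝ := fun i => pointRatio (a + b) T.minA T.maxA (T.innerLabelA i) t

/-- **The second forgetful map `f_B : ℝ^{a+b} → ℝ^b` in simplicial coordinates.**
[Brown 2009, §2.7; Brown–Carr–Schneps 2010, §2.3.2, Prop. 2.19] [cite: BrownCarrSchneps2010, Prop. 2.19] -/
def normB (t : Fin (a + b) → ℝ) : Fin b → ℝ := fun j => pointRatio (a + b) T.minB T.maxB (T.innerLabelB j) t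

/-- **The product map `f = (f_A, f_B) : ℝ^{a+b} → ℝ^{a+b}`** of the type (first `a` coordinates
`f_A`, last `b` coordinates `f_B`, as in `KZ.IntegralRep.prodDomain`): Brown's
`f_{T₁} × f_{T₂} : M_{0,S} → M_{0,T₁} × M_{0,T₂}` in simplicial coordinates on all three spaces.
[Brown 2009, §2.7, eq. (2.31); Brown–Carr–Schneps 2010, Prop. 2.19] [cite: BrownCarrSchneps2010, Prop. 2.19] -/
def prodMap (t : Fin (a + b) → ℝ) : Fin (a + b) → ℝ := Fin.append (T.normA t) (T.normB t)

/-- The first `a` coordinates of the product map are `f_A`. [folklore] -/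
@[simp] theorem prodMap_castAdd (t : Fin (a + b) → ℝ) (i : Fin a) :
    T.prodMap t (Fin.castAdd b i) = T.normA t i := by simp [prodMap]

/-- The last `b` coordinates of the product map are `f_B`. [folklore] -/
@[simp] theorem prodMap_natAdd (t : Fin (a + b) → ℝ) (j : Fin b) :
    T.prodMap t (Fin.natAdd a j) = T.normB t j := by simp [prodMap]

/-- **The Jacobian of the product map in closed form**:
`|det Df(t)| = |m_hi − m_lo| / (|m_{max A} − m_{min A}|^{a+1} · |m_{max B} − m_{min B}|^{b+1})`,
`{lo, hi} = A ∩ B` — a unit on every cell, of constant sign there. (The formula expresses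
`f^*(vol_a ∧ vol_b)` through the invariant volume forms of the three moduli spaces; it was checked
against `|det fderiv|` by exact arithmetic for all types with `a + b ≤ 5` and is evaluated for the
calibration types in `GenusZeroProductTypeProdJacobian.lean`, where its identification with
`|det Df|` is proved in general, `abs_det_fderiv_prodMap`.) [Brown–Carr–Schneps 2010, proof of Prop. 2.19 (`f^*(ω₁ ∧ ω₂)`)] [folklore] -/
def prodMapAbsDet (t : Fin (a + b) → ℝ) : ℝ :=
  |markedPoint (a + b) t T.hi - markedPoint (a + b) t T.lo| /
    (|markedPoint (a + b) t T.maxA - markedPoint (a + b) t T.minA| ^ (a + 1) *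
      |markedPoint (a + b) t T.maxB - markedPoint (a + b) t T.minB| ^ (b + 1))

/-- The denominator `m_{max A} − m_{min A}` of `f_A`. [folklore] -/
def denA (t : Fin (a + b) → ℝ) : ℝ := markedPoint (a + b) t T.maxA - markedPoint (a + b) t T.minA

/-- The denominator `m_{max B} − m_{min B}` of `f_B`. [folklore] -/
def denB (t : Fin (a + b) → ℝ) : ℝ := markedPoint (a + b) t T.maxB - markedPoint (a + b) t T.minB

/-- The denominators of `f` do not vanish where the marked points are pairwise distinct. [folklore] -/
theorem denA_ne_zero_of_injective {t : Fin (a + b) → ℝ}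
    (ht : Function.Injective (markedPoint (a + b) t)) : T.denA t ≠ 0 :=
  sub_ne_zero.mpr fun h => T.minA_lt_maxA.ne' (ht h)

/-- The denominators of `f` do not vanish where the marked points are pairwise distinct. [folklore] -/
theorem denB_ne_zero_of_injective {t : Fin (a + b) → ℝ}
    (ht : Function.Injective (markedPoint (a + b) t)) : T.denB t ≠ 0 :=
  sub_ne_zero.mpr fun h => T.minB_lt_maxB.ne' (ht h)

/-! #### Shuffles -/

/-- **The shuffles of a product type**: the arrangements `σ` of the finite labels (position `↦`
label) in which the labels of `A` appear in increasing order and so do the labels of `B` — the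
merges of the two chains `A`, `B` agreeing on `A ∩ B`, i.e. the terms of BCS's shuffle
`γ_A ш_E γ_B` relative to the common points `E = (A ∩ B) ∪ {∞}`; their cells `X_σ` are the
components of `f⁻¹(Δ_a × Δ_b)`. [Brown–Carr–Schneps 2010, Def. 2.15, Prop. 2.19; Brown 2009,
eq. (2.34) (`G_f`)] [cite: BrownCarrSchneps2010, Def. 2.15] -/
def IsShuffle (σ : Equiv.Perm (Fin (a + b + 2))) : Prop :=
  (∀ x ∈ T.A, ∀ y ∈ T.A, x < y → σ.symm x < σ.symm y) ∧
    ∀ x ∈ T.B, ∀ y ∈ T.B, x < y → σ.symm x < σ.symm y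

/-- Being a shuffle is decidable (finitely many order conditions). [folklore] -/
instance (σ : Equiv.Perm (Fin (a + b + 2))) : Decidable (T.IsShuffle σ) := by
  unfold IsShuffle; infer_instance

/-- The finite set of shuffles of the type (BCS: the terms of `γ_A ш γ_B`).
[Brown–Carr–Schneps 2010, Def. 2.15, Prop. 2.19] [cite: BrownCarrSchneps2010, Def. 2.15] -/
def shuffles : Finset (Equiv.Perm (Fin (a + b + 2))) := Finset.univ.filter T.IsShuffle

/-- Membership in `shuffles`, unfolded. [folklore] -/
@[simp] theorem mem_shuffles {σ : Equiv.Perm (Fin (a + b + 2))} : σ ∈ T.shuffles ↔ T.IsShuffle σ := by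
  simp [shuffles]

/-- The identity arrangement (the standard cell) is a shuffle of every type. [folklore] -/
theorem isShuffle_one : T.IsShuffle 1 := ⟨fun _ _ _ _ h => h, fun _ _ _ _ h => h⟩

/-- The standard cell is a shuffle cell of every type. [folklore] -/
theorem one_mem_shuffles : (1 : Equiv.Perm (Fin (a + b + 2))) ∈ T.shuffles :=
  T.mem_shuffles.mpr T.isShuffle_one

/-- In a shuffle, label `0` precedes label `a + b + 1` (so shuffle cells are the non-empty cells of
`f⁻¹(Δ_a × Δ_b)` and all normalisations have positive orientation on them). [folklore] -/
theorem IsShuffle.symm_zero_lt_symm_last {σ : Equiv.Perm (Fin (a + b + 2))} (h : T.IsShuffle σ) :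
    σ.symm 0 < σ.symm (Fin.last (a + b + 1)) := by
  have hlo := Finset.mem_inter.mp T.lo_mem
  have key : ∀ (S : Finset (Fin (a + b + 2))), T.lo ∈ S →
      (∀ x ∈ S, ∀ y ∈ S, x < y → σ.symm x < σ.symm y) →
      (0 ∈ S → σ.symm 0 ≤ σ.symm T.lo) ∧ (Fin.last (a + b + 1) ∈ S → σ.symm T.lo ≤ σ.symm (Fin.last _)) := by
    intro S hS hmono
    refine ⟨fun h0 => ?_, fun h1 => ?_⟩
    · rcases (Fin.zero_le T.lo).lt_or_eq with hlt | heq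
      · exact (hmono 0 h0 _ hS hlt).le
      · rw [heq]
    · rcases (Fin.le_last T.lo).lt_or_eq with hlt | heq
      · exact (hmono _ hS _ h1 hlt).le
      · rw [heq]
  have hA := key T.A hlo.1 h.1
  have hB := key T.B hlo.2 h.2
  have h0 : σ.symm 0 ≤ σ.symm T.lo := by
    rcases T.mem_A_or_mem_B 0 with h0 | h0
    exacts [hA.1 h0, hB.1 h0]
  have h1 : σ.symm T.lo ≤ σ.symm (Fin.last _) := by
    rcases T.mem_A_or_mem_B (Fin.last _) with h1 | h1
    exacts [hA.2 h1, hB.2 h1]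
  refine lt_of_le_of_ne (h0.trans h1) fun heq => ?_
  have := σ.symm.injective heq
  exact (Fin.last_pos' (n := a + b + 1)).ne this

/-! #### The product domain -/

/-- The product `Δ_a × Δ_b ⊆ ℝ^{a+b}` of the two factor cells (first `a` coordinates in `Δ_a`,
last `b` in `Δ_b`): the domain of `KZ.IntegralRep.prod p q` for representations `p`, `q` on the
two ordered simplices (`prodDomain_eq_simplexProd`). [Brown 2009, §2.7, eq. (2.35);
Kontsevich–Zagier 2001, §4.1] [folklore] -/
def _root_.Literature.NumberTheory.Transcendental.KZ.simplexProd (a b : ℕ) : Set (Fin (a + b) → ℝ) :=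
  {z | (fun i => z (Fin.castAdd b i)) ∈ openOrderedSimplex a ∧
    (fun j => z (Fin.natAdd a j)) ∈ openOrderedSimplex b}

/-- For representations on the two simplices, `prodDomain p q = Δ_a × Δ_b`. [folklore] -/
theorem _root_.Literature.NumberTheory.Transcendental.KZ.prodDomain_eq_simplexProd
    (p : IntegralRep a) (q : IntegralRep b)
    (hp : p.domain = openOrderedSimplex a) (hq : q.domain = openOrderedSimplex b) :
    IntegralRep.prodDomain p q = simplexProd a b := by
  ext z
  simp [IntegralRep.mem_prodDomain, simplexProd, hp, hq]

end GenusZeroProductType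

/-! ### Relabelling transports -/

/-- **The relabelling transport `T_σ : ℝ^k → ℝ^k`.** The symmetric group of the labels acts on
`M_{0,k+3}` by relabelling the marked points (Brown–Carr–Schneps 2010, §2.3.3, eq. (2.17):
`∫_{X_γ} ω = ∫_{X_{τ(γ)}} ω_{τ(·)}`); `T_σ` is the action, in simplicial coordinates, of the label
permutation fixing `∞` that carries the standard cell `Δ_k = X_1` onto the cell `X_σ`: put the
point with label `σ p` where the point with label `p` was (`w_s = m_{σ⁻¹ s}`) and renormalise by the
affine map `w_0 ↦ 0`, `w_{k+1} ↦ 1`. Coordinatewise,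
`m_s(T_σ t) = (m_{σ⁻¹ s}(t) − m_{σ⁻¹ 0}(t)) / (m_{σ⁻¹ (k+1)}(t) − m_{σ⁻¹ 0}(t))`, a Möbius-coordinate
(rational) map. [Brown–Carr–Schneps 2010, §2.3.3 eq. (2.17), Def. 2.22 (`τ_γ`); Brown 2009, Lemma 2.5 context] [cite: BrownCarrSchneps2010, §2.3.3] -/
def relabelTransport (k : ℕ) (σ : Equiv.Perm (Fin (k + 2))) (t : Fin k → ℝ) : Fin k → ℝ :=
  fun i => pointRatio k (σ.symm 0) (σ.symm (Fin.last (k + 1))) (σ.symm (coordLabel k i)) t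

/-- The denominator of the transport `T_σ`: `m_{σ⁻¹(k+1)} − m_{σ⁻¹ 0}` (positive on `Δ_k` for a
shuffle `σ`). [folklore] -/
def relabelDen (k : ℕ) (σ : Equiv.Perm (Fin (k + 2))) (t : Fin k → ℝ) : ℝ :=
  markedPoint k t (σ.symm (Fin.last (k + 1))) - markedPoint k t (σ.symm 0)

/-- **The Jacobian of the transport in closed form**: `|det DT_σ(t)| = |m_{σ⁻¹(k+1)}(t) − m_{σ⁻¹ 0}(t)|^{-(k+1)}`
(`= 1` when `σ` fixes the labels `0` and `k + 1`, in which case `T_σ` is a coordinate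
permutation); identified with `|det DT_σ|` in `GenusZeroProductTypeJacobian.lean`
(`abs_det_fderiv_relabelTransport`). [folklore] -/
def relabelAbsDet (k : ℕ) (σ : Equiv.Perm (Fin (k + 2))) (t : Fin k → ℝ) : ℝ :=
  (|relabelDen k σ t| ^ (k + 1))⁻¹

/-- Unfolding the transport coordinatewise. [folklore] -/
theorem relabelTransport_apply (σ : Equiv.Perm (Fin (k + 2))) (t : Fin k → ℝ) (i : Fin k) :
    relabelTransport k σ t i =
      (markedPoint k t (σ.symm (coordLabel k i)) - markedPoint k t (σ.symm 0)) / relabelDen k σ t :=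
  rfl

/-- The inverse of the identity arrangement is the identity (`rfl`; avoids a deprecated simp
lemma). [folklore] -/
theorem one_symm_eq (n : ℕ) : (1 : Equiv.Perm (Fin n)).symm = 1 := rfl

/-- The identity relabelling is the identity map. [folklore] -/
@[simp] theorem relabelTransport_one (k : ℕ) : relabelTransport k 1 = id := by
  ext t i
  simp [relabelTransport, one_symm_eq]

/-- The denominator of the identity relabelling is `1`. [folklore] -/
@[simp] theorem relabelDen_one (t : Fin k → ℝ) : relabelDen k 1 t = 1 := by
  simp [relabelDen, one_symm_eq]

/-- The Jacobian of the identity relabelling is `1`. [folklore] -/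
@[simp] theorem relabelAbsDet_one (t : Fin k → ℝ) : relabelAbsDet k 1 t = 1 := by
  simp [relabelAbsDet]

/-- On the generic locus no transport has a pole. [folklore] -/
theorem relabelDen_ne_zero_of_mem_genericLocus (σ : Equiv.Perm (Fin (k + 2))) {t : Fin k → ℝ}
    (ht : t ∈ genericLocus k) : relabelDen k σ t ≠ 0 :=
  sub_ne_zero.mpr fun h => (Fin.last_pos' (n := k + 1)).ne' (σ.symm.injective (ht h))

end KZ

end Literature.NumberTheory.Transcendental
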